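/-
Copyright (c) 2026 the pub-hodgecm-mathlib formalisation cell (harness21).  Prover seat hodgecm-mathlib-LH3-p03 (g4) on line LH3 (closer stub `stub_N9`, N9 «Transf» direct
road), organ J, brick (G′-CANCEL): the split-torus Haar binder `σ` of ★ `exists_hmap_hmapβ_descentConst_eq_of_clauses` from the shared datum itself; 2026-09-02.
-/
import Literature.NumberTheory.Automorphic.ArchSharedRankOneDatum        -- ★ p850571 (F0P3-p02 (g18)) (DATUM-INST); brings ★ `exists_nonneg_cone_ne_zero` (J-CONST kit), `torusU`, `hypBlockGL_mem_*`, ★ `isInvInvariant_of_comm`, ★ `quotientMeasure`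
import Literature.NumberTheory.Automorphic.ArchRankOneJumpConstUnique     -- ★ p850433 (F0P3a-p07 (g16)) (J-CONST): `exists_nonneg_cone_ne_zero`
import Literature.NumberTheory.Automorphic.ArchEndoscopicCartanAtlas        -- ★ `continuous_hypBlockGL`
import HarnessLib

/-!
# The shared rank-one datum pins a box-positive Haar measure on the split torus — for EVERY frame `J = Φ₂ over ℂ`, from (A0) and (LINK) alone
# (Varadarajan 1989 §6.4 Lemma 21; Rogawski 1990 §4.9 p. 55, §8.2 p. 122; Folland 1995 §2.2)

Topic `NumberTheory/Automorphic`; namespace `Literature.NumberTheory.Automorphic.UnitaryGroup`.  THEOREMS ONLY (no `def`, no instance, no notation, no axiom, no named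
fact, no `sorry`); kernel lane `--kind proof --supports stmt-HodgeConjecture-24833`.  Cell `pub/hodgecm-mathlib`, crux H413 (`stmt-HodgeConjecture-24833`), F0∕P3c line LH3
(closer stub `stub_N9`, DIRECT ROAD, organ J, residual `stub_N9jumpGSide : JumpGSideStatement` of skeleton v3.6), brick (G′-CANCEL) (seat LH3-p03 (g4)).
★ `exists_hmap_hmapβ_descentConst_eq_of_clauses` (p850673) binds ONE inversion-invariant Haar measure `σ` on the split torus `torusU ⊂ U(J)` with
`σ(B_std) ≠ 0, ≠ ⊤`.  On the H side this is ★ `measure_image_hypBlockGL_box_pos_lt_top` (LH10-p02 (g4), p850593) — but that lemma is stated for the place frame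
`J = σ_w Φ₂`, whereas `JumpGSideStatement` quantifies over an ARBITRARY `J` with `hJ : J = Φ₂ over ℂ`.  This file discharges `σ` J-GENERICALLY and WITHOUT any chart
geometry, from the statement's own binders: (A0) with `0 < C₂` forces `μ₀′ ≠ 0` (★ `exists_nonneg_cone_ne_zero`: some test function has non-zero cone value, and the
(A0) limit of the identically-zero functional would be `C₂ • cone`), and then (LINK) `μ₀′ = ρ(B_std) • (μ₀ ∕ ρ)` forces `ρ(B_std) ≠ 0` for EVERY inversion-invariant Haar
`ρ` on the torus; `ρ(B_std) < ⊤` because `B_std` is a continuous image of the compact box (★ `continuous_hypBlockGL`); and such a `ρ` exists (Haar measure of the closed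
abelian torus, inversion invariant by ★ `isInvInvariant_of_comm`).
* **`ne_zero_of_sharedA0`** — `0 < C₂ ∧ (A0) ⇒ μ₀′ ≠ 0`;
* **`measure_box_ne_zero_of_sharedLink`** — `μ₀′ ≠ 0 ∧ (LINK) ⇒ ρ(B_std) ≠ 0` for every admissible `ρ`; **`measure_box_ne_top`** — `ρ(B_std) ≠ ⊤` (any measure finite on compacta);
* **`exists_isHaarMeasure_isInvInvariant_torusU_box`** — the `σ`, `hσ0`, `hσt` binders of ★ p850673 in ONE `obtain`, from `μ₀′ ≠ 0` and (LINK).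
HONEST LABEL: HC_CM is proved only modulo the 7 printed citations (2 remaining named inputs: hLiu418 = `stmt-HodgeConjecture-24832`, h413 = `stmt-HodgeConjecture-24833`) until
rung 0 closes; count-neutral bookkeeping under organ J of `stub_N9`.

## References
* [Varadarajan1989] V. S. Varadarajan, *An Introduction to Harmonic Analysis on Semisimple Lie Groups*, Cambridge Stud. Adv. Math. 16 (1989), §6.4 Lemma 21 (c), Thm 23.
* [Rogawski1990] J. D. Rogawski, *Automorphic Representations of Unitary Groups in Three Variables*, Ann. of Math. Stud. 123 (1990), §4.9 p. 55, §8.2 p. 122.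
* [Folland1995] G. B. Folland, *A Course in Abstract Harmonic Analysis* (1995), §2.2 (Haar measure on locally compact abelian groups).
-/

set_option autoImplicit false

noncomputable section

namespace Literature.NumberTheory.Automorphic.UnitaryGroup

open _root_.MeasureTheory Measure Set Filter _root_.Topology _root_.Complex
open Literature.NumberTheory.Automorphic.Shelstad1979.StableOrbitalIntegrals Literature.MeasureTheory.Group
open Literature.NumberTheory.Automorphic Literature.NumberTheory.Rogawski1990
open scoped Real MatrixGroups ENNReal NNReal ComplexConjugate

variable {J : Matrix (Fin 2) (Fin 2) ℂ} (hJ : J = (StdForm.antidiagonal 2).over ℂ)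

/-! ## §1 (A0) with `0 < C₂` forces `μ₀′ ≠ 0` -/

include hJ in
/-- **`μ₀′ ≠ 0` FROM (A0).**  If the (A0) limit `|eˣ − e⁻ˣ| • ∫ descConj(hypBlockGL x θ)(f ∘ coe) dμ₀′ → C₂ • (cone⁺ + cone⁻)(f, e^{iθ})` holds for every `f ∈ C_c(M₂(ℂ), ℂ)` and every
`θ` (the `SharedA0` text of the shared datum, ★ `eq_of_tendsto_cone`'s `hC`), with `0 < C₂`, then `μ₀′ ≠ 0`: for `μ₀′ = 0` the functional is identically `0`, so its limit
`C₂ • cone(f, 1)` would vanish for every `f` — against ★ `exists_nonneg_cone_ne_zero`. [cite: Varadarajan1989, §6.4 Lemma 21 (c), Thm 23] [cite: Rogawski1990, §8.2 p. 122] -/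
theorem ne_zero_of_sharedA0
    [MeasurableSpace ↥(unitaryGroupOfForm (starRingEnd ℂ) J)]
    [MeasurableSpace (↥(unitaryGroupOfForm (starRingEnd ℂ) J) ⧸ torusU (starRingEnd ℂ) J)]
    (μ₀' : Measure (↥(unitaryGroupOfForm (starRingEnd ℂ) J) ⧸ torusU (starRingEnd ℂ) J)) {C₂ : ℝ} (hC₂ : 0 < C₂)
    (hA0 : ∀ (f : Matrix (Fin 2) (Fin 2) ℂ → ℂ), Continuous f → HasCompactSupport f → ∀ θ : ℝ,
      Tendsto (fun x : ℝ => |Real.exp x - Real.exp (-x)| •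
          ∫ y, descConj (⟨hypBlockGL x θ, hypBlockGL_mem_of_eq_over hJ x θ⟩ : ↥(unitaryGroupOfForm (starRingEnd ℂ) J)) (torusU (starRingEnd ℂ) J)
            (LineRing.forall_mem_torusU_comm (starRingEnd ℂ) J (hypBlockGL_mem_torusU hJ x θ))
            (fun g : ↥(unitaryGroupOfForm (starRingEnd ℂ) J) => f ((g : GL (Fin 2) ℂ) : Matrix (Fin 2) (Fin 2) ℂ)) y ∂μ₀')
        (𝓝[≠] 0)
        (𝓝 (C₂ • ((∫ p in Ioi (0 : ℝ) ×ˢ Ioc (0 : ℝ) (2 * π),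
            f ((!![(1 : ℂ), 1; 1, -1] : Matrix (Fin 2) (Fin 2) ℂ) *
              (Complex.exp ((θ : ℂ) * Complex.I) • (1 : Matrix (Fin 2) (Fin 2) ℂ) +
                p.1 • Matrix.diagonal ![Complex.exp ((θ : ℂ) * Complex.I) * Complex.I, -(Complex.exp ((θ : ℂ) * Complex.I) * Complex.I)] +
                p.1 • !![(0 : ℂ), -(Complex.exp ((θ : ℂ) * Complex.I) * Complex.I) * Complex.exp (-((p.2 : ℂ) * Complex.I));
                  (Complex.exp ((θ : ℂ) * Complex.I) * Complex.I) * Complex.exp ((p.2 : ℂ) * Complex.I), 0]) *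
              !![(1 / 2 : ℂ), 1 / 2; 1 / 2, -(1 / 2)])) +
          ∫ p in Ioi (0 : ℝ) ×ˢ Ioc (0 : ℝ) (2 * π),
            f ((!![(1 : ℂ), 1; 1, -1] : Matrix (Fin 2) (Fin 2) ℂ) *
              (Complex.exp ((θ : ℂ) * Complex.I) • (1 : Matrix (Fin 2) (Fin 2) ℂ) +
                p.1 • Matrix.diagonal ![-(Complex.exp ((θ : ℂ) * Complex.I) * Complex.I), Complex.exp ((θ : ℂ) * Complex.I) * Complex.I] +
                p.1 • !![(0 : ℂ), (Complex.exp ((θ : ℂ) * Complex.I) * Complex.I) * Complex.exp (-((p.2 : ℂ) * Complex.I));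
                  -(Complex.exp ((θ : ℂ) * Complex.I) * Complex.I) * Complex.exp ((p.2 : ℂ) * Complex.I), 0]) *
              !![(1 / 2 : ℂ), 1 / 2; 1 / 2, -(1 / 2)]))))) :
    μ₀' ≠ 0 := by
  intro h0
  haveI : Fact (0 < 2 * π) := ⟨Real.two_pi_pos⟩
  have hz : Complex.exp (((0 : ℝ) : ℂ) * Complex.I) ≠ 0 := Complex.exp_ne_zero _
  obtain ⟨f, hf, hfc, -, hcone⟩ := exists_nonneg_cone_ne_zero (Complex.exp (((0 : ℝ) : ℂ) * Complex.I)) hz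
  have hlim := hA0 f hf hfc 0
  -- with `μ₀′ = 0` the functional vanishes identically
  have hzero : (fun x : ℝ => |Real.exp x - Real.exp (-x)| •
      ∫ y, descConj (⟨hypBlockGL x 0, hypBlockGL_mem_of_eq_over hJ x 0⟩ : ↥(unitaryGroupOfForm (starRingEnd ℂ) J)) (torusU (starRingEnd ℂ) J)
        (LineRing.forall_mem_torusU_comm (starRingEnd ℂ) J (hypBlockGL_mem_torusU hJ x 0))
        (fun g : ↥(unitaryGroupOfForm (starRingEnd ℂ) J) => f ((g : GL (Fin 2) ℂ) : Matrix (Fin 2) (Fin 2) ℂ)) y ∂μ₀') = fun _ => 0 := by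
    funext x
    rw [h0, integral_zero_measure, smul_zero]
  rw [hzero] at hlim
  have heq := tendsto_nhds_unique (tendsto_const_nhds (x := (0 : ℂ)) (f := (𝓝[≠] (0 : ℝ)))) hlim
  rw [eq_comm, smul_eq_zero] at heq
  rcases heq with h | h
  · exact (lt_irrefl (0 : ℝ)) (h ▸ hC₂)
  · exact hcone h

/-! ## §2 (LINK) then pins `ρ(B_std) ≠ 0` for every admissible `ρ`; `ρ(B_std) < ⊤` always -/

include hJ in
/-- **`ρ(B_std) ≠ 0` FROM (LINK)**: if `μ₀′ ≠ 0` and `μ₀′ = ρ(B_std) • (μ₀ ∕ ρ)` (the `SharedLink` text at this `ρ`), then `ρ(B_std) ≠ 0`. [cite: Rogawski1990, §4.9 p. 55] -/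
theorem measure_box_ne_zero_of_sharedLink
    [MeasurableSpace ↥(unitaryGroupOfForm (starRingEnd ℂ) J)] [BorelSpace ↥(unitaryGroupOfForm (starRingEnd ℂ) J)]
    [LocallyCompactSpace ↥(unitaryGroupOfForm (starRingEnd ℂ) J)] [SecondCountableTopology ↥(unitaryGroupOfForm (starRingEnd ℂ) J)]
    [MeasurableSpace (↥(unitaryGroupOfForm (starRingEnd ℂ) J) ⧸ torusU (starRingEnd ℂ) J)] [BorelSpace (↥(unitaryGroupOfForm (starRingEnd ℂ) J) ⧸ torusU (starRingEnd ℂ) J)]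
    (μ₀ : Measure ↥(unitaryGroupOfForm (starRingEnd ℂ) J)) [μ₀.IsHaarMeasure] [μ₀.IsMulRightInvariant]
    (μ₀' : Measure (↥(unitaryGroupOfForm (starRingEnd ℂ) J) ⧸ torusU (starRingEnd ℂ) J)) (hμ₀' : μ₀' ≠ 0)
    (ρ : Measure ↥(torusU (starRingEnd ℂ) J)) [ρ.IsHaarMeasure] [ρ.IsInvInvariant]
    (hlinkρ : μ₀' = ρ ((fun q : ℝ × ℝ => (⟨⟨hypBlockGL q.1 q.2, hypBlockGL_mem_of_eq_over hJ q.1 q.2⟩, hypBlockGL_mem_torusU hJ q.1 q.2⟩ : ↥(torusU (starRingEnd ℂ) J))) ''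
        (Set.Icc (0 : ℝ) 1 ×ˢ Set.Icc (0 : ℝ) (2 * π))) •
      quotientMeasure (torusU (starRingEnd ℂ) J) ρ (LineRing.isClosed_torusU_two (starRingEnd ℂ) J) μ₀) :
    ρ ((fun q : ℝ × ℝ => (⟨⟨hypBlockGL q.1 q.2, hypBlockGL_mem_of_eq_over hJ q.1 q.2⟩, hypBlockGL_mem_torusU hJ q.1 q.2⟩ : ↥(torusU (starRingEnd ℂ) J))) ''
        (Set.Icc (0 : ℝ) 1 ×ˢ Set.Icc (0 : ℝ) (2 * π))) ≠ 0 := by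
  intro h
  apply hμ₀'
  rw [hlinkρ, h, zero_smul]

include hJ in
/-- **`ρ(B_std) < ⊤`** for every measure finite on compacta: `B_std` is the image of the compact box `[0,1] × [0,2π]` under the continuous `(x, θ) ↦ hypBlockGL x θ`
(★ `continuous_hypBlockGL`). [cite: Folland1995, §2.2] -/
theorem measure_box_ne_top [MeasurableSpace ↥(unitaryGroupOfForm (starRingEnd ℂ) J)]
    (ρ : Measure ↥(torusU (starRingEnd ℂ) J)) [IsFiniteMeasureOnCompacts ρ] :
    ρ ((fun q : ℝ × ℝ => (⟨⟨hypBlockGL q.1 q.2, hypBlockGL_mem_of_eq_over hJ q.1 q.2⟩, hypBlockGL_mem_torusU hJ q.1 q.2⟩ : ↥(torusU (starRingEnd ℂ) J))) ''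
        (Set.Icc (0 : ℝ) 1 ×ˢ Set.Icc (0 : ℝ) (2 * π))) ≠ ⊤ := by
  have hcont : Continuous (fun q : ℝ × ℝ =>
      (⟨⟨hypBlockGL q.1 q.2, hypBlockGL_mem_of_eq_over hJ q.1 q.2⟩, hypBlockGL_mem_torusU hJ q.1 q.2⟩ : ↥(torusU (starRingEnd ℂ) J))) :=
    (continuous_hypBlockGL.subtype_mk _).subtype_mk _
  exact (((isCompact_Icc.prod isCompact_Icc).image hcont).measure_lt_top (μ := ρ)).ne

/-! ## §3 The `σ` binder of ★ `exists_hmap_hmapβ_descentConst_eq_of_clauses`, in one `obtain` -/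

include hJ in
/-- **A BOX-POSITIVE INVERSION-INVARIANT HAAR MEASURE ON THE SPLIT TORUS, FROM THE SHARED DATUM** (J-generic): given `μ₀′ ≠ 0` (§1, from (A0) and `0 < C₂`) and the
(LINK) text `∀ ρ, μ₀′ = ρ(B_std) • (μ₀ ∕ ρ)`, there is a Haar measure `σ` on `torusU ⊂ U(J)`, inversion invariant (the torus is closed and abelian, ★ `isInvInvariant_of_comm`),
with `σ(B_std) ≠ 0` (§2) and `σ(B_std) ≠ ⊤` — exactly the binders `σ hσ0 hσt` of ★ `exists_hmap_hmapβ_descentConst_eq_of_clauses` (p850673).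
[cite: Folland1995, §2.2] [cite: Rogawski1990, §4.9 p. 55; §8.2 p. 122] [cite: Varadarajan1989, §6.4 Lemma 21] -/
theorem exists_isHaarMeasure_isInvInvariant_torusU_box
    [MeasurableSpace ↥(unitaryGroupOfForm (starRingEnd ℂ) J)] [BorelSpace ↥(unitaryGroupOfForm (starRingEnd ℂ) J)]
    [LocallyCompactSpace ↥(unitaryGroupOfForm (starRingEnd ℂ) J)] [SecondCountableTopology ↥(unitaryGroupOfForm (starRingEnd ℂ) J)]
    [MeasurableSpace (↥(unitaryGroupOfForm (starRingEnd ℂ) J) ⧸ torusU (starRingEnd ℂ) J)] [BorelSpace (↥(unitaryGroupOfForm (starRingEnd ℂ) J) ⧸ torusU (starRingEnd ℂ) J)]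
    (μ₀ : Measure ↥(unitaryGroupOfForm (starRingEnd ℂ) J)) [μ₀.IsHaarMeasure] [μ₀.IsMulRightInvariant]
    (μ₀' : Measure (↥(unitaryGroupOfForm (starRingEnd ℂ) J) ⧸ torusU (starRingEnd ℂ) J)) (hμ₀' : μ₀' ≠ 0)
    (hlink : ∀ (ρ : Measure ↥(torusU (starRingEnd ℂ) J)) [ρ.IsHaarMeasure] [ρ.IsInvInvariant],
      μ₀' = ρ ((fun q : ℝ × ℝ => (⟨⟨hypBlockGL q.1 q.2, hypBlockGL_mem_of_eq_over hJ q.1 q.2⟩, hypBlockGL_mem_torusU hJ q.1 q.2⟩ : ↥(torusU (starRingEnd ℂ) J))) ''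
          (Set.Icc (0 : ℝ) 1 ×ˢ Set.Icc (0 : ℝ) (2 * π))) •
        quotientMeasure (torusU (starRingEnd ℂ) J) ρ (LineRing.isClosed_torusU_two (starRingEnd ℂ) J) μ₀) :
    ∃ (σ : Measure ↥(torusU (starRingEnd ℂ) J)) (_ : σ.IsHaarMeasure) (_ : σ.IsInvInvariant),
      σ ((fun q : ℝ × ℝ => (⟨⟨hypBlockGL q.1 q.2, hypBlockGL_mem_of_eq_over hJ q.1 q.2⟩, hypBlockGL_mem_torusU hJ q.1 q.2⟩ : ↥(torusU (starRingEnd ℂ) J))) ''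
          (Set.Icc (0 : ℝ) 1 ×ˢ Set.Icc (0 : ℝ) (2 * π))) ≠ 0 ∧
      σ ((fun q : ℝ × ℝ => (⟨⟨hypBlockGL q.1 q.2, hypBlockGL_mem_of_eq_over hJ q.1 q.2⟩, hypBlockGL_mem_torusU hJ q.1 q.2⟩ : ↥(torusU (starRingEnd ℂ) J))) ''
          (Set.Icc (0 : ℝ) 1 ×ˢ Set.Icc (0 : ℝ) (2 * π))) ≠ ⊤ := by
  have hTc : IsClosed (torusU (starRingEnd ℂ) J : Set ↥(unitaryGroupOfForm (starRingEnd ℂ) J)) := LineRing.isClosed_torusU_two (starRingEnd ℂ) J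
  haveI : LocallyCompactSpace ↥(torusU (starRingEnd ℂ) J) := hTc.isClosedEmbedding_subtypeVal.locallyCompactSpace
  let σ : Measure ↥(torusU (starRingEnd ℂ) J) := haarMeasure (Classical.arbitrary (TopologicalSpace.PositiveCompacts ↥(torusU (starRingEnd ℂ) J)))
  haveI : σ.IsInvInvariant :=
    isInvInvariant_of_comm (torusU (starRingEnd ℂ) J) hTc (fun x hx y hy => LineRing.forall_mem_torusU_comm (starRingEnd ℂ) J hy x hx) σ
  exact ⟨σ, inferInstance, inferInstance, measure_box_ne_zero_of_sharedLink hJ μ₀ μ₀' hμ₀' σ (hlink σ), measure_box_ne_top hJ σ⟩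

end Literature.NumberTheory.Automorphic.UnitaryGroup

end
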